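import Summits.AtomisticToContinuum.FouriersLaw.Theorems.ParityLiouvilleSeedLiouvilleForHeatHarmonicCovariance
import Literature.MathematicalPhysics.KineticTheory.InfiniteChainVariationalCalculus

/-!
# The radiating Gaussian state of the harmonic chain: shift invariance, moments, current

Helper file for the harmonic tightness witness of `ParityLiouvilleSeed.LiouvilleForHeat`
(`stmt-AtomisticToContinuum-13980`) / `ZeroCurrentRigidity` (`stmt-AtomisticToContinuum-12073`);
objects in `ParityLiouvilleSeedLiouvilleForHeatHarmonicDefs`, covariances in
`ParityLiouvilleSeedLiouvilleForHeatHarmonicCovariance`.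

* `isShiftInvariant_harmonicState` — the state is translation invariant (the noise law is invariant
  under the index shift, `Measure.map_infinitePi_infinitePi_of_inj`, and the field intertwines);
* `moments_harmonicState` — all polynomial site moments are finite and bounded uniformly in the
  site (translation-boundedness, in the exact shape of the route statements);
* `integrable_bondCurrentZ_harmonicState`, `integral_bondCurrentZ_harmonicState` — for the
  harmonic chain `pinnedChain ω₂ 0 0 γ` the bond current `j₀ = -½(p₀ + p₁)(q₁ - q₀)` is integrable
  with **mean `-1/2`**: the state carries a non-zero energy current.
-/

noncomputable section

open MeasureTheory ProbabilityTheory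
open scoped NNReal ENNReal
open Literature.MathematicalPhysics.KineticTheory.HeatConduction

namespace Summit.AtomisticToContinuum.FouriersLaw.Theorems.ParityLiouvilleSeed.HarmonicWitness

variable (ω₂ : ℝ)

/-! ### Shift invariance -/

/-- The noise law is invariant under the index shift `ζ ↦ ζ ∘ idxShift.symm`. [folklore] -/
theorem noiseMeasure_map_comp_idxShift_symm :
    (noiseMeasure ω₂).map (fun ζ : Src => ζ ∘ idxShift.symm) = noiseMeasure ω₂ := by
  unfold noiseMeasure
  exact Measure.map_infinitePi_infinitePi_of_inj
    (P := fun k : Idx => gaussianReal 0 (noiseVar ω₂ k.2)) idxShift.symm.injective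

/-- Measurability of the index shift on the noise. [folklore] -/
theorem measurable_comp_idxShift_symm : Measurable fun ζ : Src => ζ ∘ idxShift.symm :=
  measurable_pi_lambda _ fun _ => measurable_pi_apply _

/-- **The radiating Gaussian state is shift invariant.** [folklore] -/
theorem isShiftInvariant_harmonicState : IsShiftInvariant (harmonicState ω₂) := by
  unfold IsShiftInvariant harmonicState
  rw [Measure.map_map shift_measurable measurable_gaussField]
  have h : shift ∘ gaussField = gaussField ∘ fun ζ : Src => ζ ∘ idxShift.symm :=
    funext fun ζ => (gaussField_comp_idxShift_symm ζ).symm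
  rw [h, ← Measure.map_map measurable_gaussField measurable_comp_idxShift_symm,
    noiseMeasure_map_comp_idxShift_symm]

/-! ### Moments -/

/-- Site observables have site-independent integrals under a shift-invariant measure. [folklore] -/
theorem integral_site_eq_integral_zero {ν : Measure ChainConfig} (hν : IsShiftInvariant ν)
    (F : ℝ × ℝ → ℝ) (x : ℤ) : ∫ σ, F (σ x) ∂ν = ∫ σ, F (σ 0) ∂ν := by
  induction x using Int.induction_on with
  | zero => rfl
  | succ n ih =>
    rw [← ih]
    exact hν.integral_comp_shift fun σ => F (σ (n : ℤ))
  | pred n ih =>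
    rw [← ih]
    have h := integral_map_equiv shiftEquiv.symm (fun σ : ChainConfig => F (σ (-(n : ℤ)))) (μ := ν)
    rw [hν.map_shiftEquiv_symm] at h
    simp only [shiftEquiv_symm_apply] at h
    exact h.symm

/-- Integrability of site observables is site independent under a shift-invariant measure.
[folklore] -/
theorem integrable_site_iff_integrable_zero {ν : Measure ChainConfig} (hν : IsShiftInvariant ν)
    (F : ℝ × ℝ → ℝ) (x : ℤ) :
    Integrable (fun σ : ChainConfig => F (σ x)) ν ↔ Integrable (fun σ : ChainConfig => F (σ 0)) ν := by
  induction x using Int.induction_on with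
  | zero => exact Iff.rfl
  | succ n ih =>
    rw [← ih]
    exact hν.integrable_comp_shift_iff fun σ => F (σ (n : ℤ))
  | pred n ih =>
    rw [← ih]
    have h := integrable_map_equiv shiftEquiv.symm (fun σ : ChainConfig => F (σ (-(n : ℤ)))) (μ := ν)
    rw [hν.map_shiftEquiv_symm] at h
    rw [h]
    have e : ((fun σ : ChainConfig => F (σ (-(n : ℤ)))) ∘ shiftEquiv.symm) =
        fun σ : ChainConfig => F (σ (-(n : ℤ) - 1)) := by
      funext σ
      simp only [Function.comp_apply, shiftEquiv_symm_apply]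
    rw [e]

/-- `|X|^m` is integrable when `X` is in every `L^p`. [folklore] -/
theorem integrable_abs_pow_of_memLp {α : Type*} [MeasurableSpace α] {μ : Measure α} [IsFiniteMeasure μ]
    {X : α → ℝ} (hX : ∀ p : ℝ≥0∞, p ≠ ∞ → MemLp X p μ) (m : ℕ) :
    Integrable (fun a => |X a| ^ m) μ := by
  have h := (hX (m : ℝ≥0∞) (by simp)).integrable_norm_pow'
  simpa only [Real.norm_eq_abs] using h

/-- **Translation-boundedness of the radiating Gaussian state**: every polynomial site moment is
finite and bounded uniformly in the site. [folklore] -/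
theorem moments_harmonicState (m : ℕ) : ∃ C : ℝ, ∀ x : ℤ,
    Integrable (fun σ : ChainConfig => |(σ x).1| ^ m + |(σ x).2| ^ m) (harmonicState ω₂) ∧
      ∫ σ, (|(σ x).1| ^ m + |(σ x).2| ^ m) ∂harmonicState ω₂ ≤ C := by
  have hS := isShiftInvariant_harmonicState ω₂
  have h0 : Integrable (fun σ : ChainConfig => |(σ 0).1| ^ m + |(σ 0).2| ^ m) (harmonicState ω₂) := by
    have hmeas : AEStronglyMeasurable (fun σ : ChainConfig => |(σ 0).1| ^ m + |(σ 0).2| ^ m)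
        (harmonicState ω₂) := by
      refine Measurable.aestronglyMeasurable ?_
      exact ((measurable_pi_apply 0).fst.abs.pow_const m).add ((measurable_pi_apply 0).snd.abs.pow_const m)
    rw [integrable_harmonicState_iff ω₂ hmeas]
    show Integrable (fun ζ : Src => |(gaussField ζ 0).1| ^ m + |(gaussField ζ 0).2| ^ m) (noiseMeasure ω₂)
    exact (integrable_abs_pow_of_memLp (memLp_gaussField_fst ω₂ 0) m).add
      (integrable_abs_pow_of_memLp (memLp_gaussField_snd ω₂ 0) m)
  refine ⟨∫ σ, (|(σ 0).1| ^ m + |(σ 0).2| ^ m) ∂harmonicState ω₂, fun x => ⟨?_, ?_⟩⟩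
  · exact (integrable_site_iff_integrable_zero hS (fun z : ℝ × ℝ => |z.1| ^ m + |z.2| ^ m) x).mpr h0
  · exact (integral_site_eq_integral_zero hS (fun z : ℝ × ℝ => |z.1| ^ m + |z.2| ^ m) x).le

/-- Second moments: `E q_x² = 1`. [folklore] -/
theorem integral_q_sq (x : ℤ) : ∫ ζ, (gaussField ζ x).1 ^ 2 ∂noiseMeasure ω₂ = 1 := by
  have h := integral_q_mul_q ω₂ x x
  simp only [if_true] at h
  simpa only [pow_two] using h

/-- Second moments: `E p_x² = v₁ + 2` (`= ω₂ + 2` for `ω₂ ≥ 0`). [folklore] -/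
theorem integral_p_sq (x : ℤ) :
    ∫ ζ, (gaussField ζ x).2 ^ 2 ∂noiseMeasure ω₂ = (noiseVar ω₂ 1 : ℝ) + 2 := by
  have h := integral_p_mul_p ω₂ x x
  have h1 : ¬ (x + 1 = x) := by omega
  have h2 : ¬ (x - 1 = x) := by omega
  simp only [if_true, h1, h2, if_false, mul_one, sub_zero] at h
  simpa only [pow_two] using h

/-! ### The energy current of the harmonic chain in the radiating state -/

/-- The bond current of the harmonic chain: `j₀(σ) = -((p₀ + p₁)/2)(q₁ - q₀)`. [folklore] -/
theorem bondCurrentZ_harmonic (γ : ℝ) (σ : ChainConfig) :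
    (pinnedChain ω₂ 0 0 γ).bondCurrentZ σ 0 = -(((σ 0).2 + (σ 1).2) / 2 * ((σ 1).1 - (σ 0).1)) := by
  rw [OscillatorChain.bondCurrentZ, pinnedChain_deriv_V_eq]
  simp

/-- The bond current in the noise coordinates, expanded. [folklore] -/
theorem bondCurrentZ_harmonic_gaussField (γ : ℝ) (ζ : Src) :
    (pinnedChain ω₂ 0 0 γ).bondCurrentZ (gaussField ζ) 0 =
      -(1 / 2) * ((gaussField ζ 1).1 * (gaussField ζ 0).2 - (gaussField ζ 0).1 * (gaussField ζ 0).2 +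
        (gaussField ζ 1).1 * (gaussField ζ 1).2 - (gaussField ζ 0).1 * (gaussField ζ 1).2) := by
  rw [bondCurrentZ_harmonic]
  ring

/-- Products `q_a p_y` are integrable against the noise. [folklore] -/
theorem integrable_q_mul_p (a y : ℤ) :
    Integrable (fun ζ : Src => (gaussField ζ a).1 * (gaussField ζ y).2) (noiseMeasure ω₂) :=
  (memLp_gaussField_fst ω₂ a 2 (by simp)).integrable_mul (memLp_gaussField_snd ω₂ y 2 (by simp))

/-- **The bond current is integrable** in the radiating state of the harmonic chain. [folklore] -/
theorem integrable_bondCurrentZ_harmonicState (γ : ℝ) :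
    Integrable (fun σ => (pinnedChain ω₂ 0 0 γ).bondCurrentZ σ 0) (harmonicState ω₂) := by
  rw [integrable_harmonicState_iff ω₂ (measurable_bondCurrentZ _ 0).aestronglyMeasurable]
  have e : ((fun σ => (pinnedChain ω₂ 0 0 γ).bondCurrentZ σ 0) ∘ gaussField) = fun ζ : Src =>
      -(1 / 2) * ((gaussField ζ 1).1 * (gaussField ζ 0).2 - (gaussField ζ 0).1 * (gaussField ζ 0).2 +
        (gaussField ζ 1).1 * (gaussField ζ 1).2 - (gaussField ζ 0).1 * (gaussField ζ 1).2) :=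
    funext fun ζ => bondCurrentZ_harmonic_gaussField ω₂ γ ζ
  rw [e]
  have hI := integrable_q_mul_p ω₂
  exact ((((hI 1 0).sub (hI 0 0)).add (hI 1 1)).sub (hI 0 1)).const_mul _

/-- **The radiating state carries the energy current `-1/2`**:
`∫ j₀ d(harmonicState ω₂) = -½ (E q₁p₀ - E q₀p₀ + E q₁p₁ - E q₀p₁) = -½ (½ - 0 + 0 + ½) = -½`.
[folklore] -/
theorem integral_bondCurrentZ_harmonicState (γ : ℝ) :
    ∫ σ, (pinnedChain ω₂ 0 0 γ).bondCurrentZ σ 0 ∂harmonicState ω₂ = -(1 / 2) := by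
  rw [integral_harmonicState ω₂ (measurable_bondCurrentZ _ 0).aestronglyMeasurable]
  simp_rw [bondCurrentZ_harmonic_gaussField]
  have hI := integrable_q_mul_p ω₂
  have h12 : Integrable (fun ζ : Src => (gaussField ζ 1).1 * (gaussField ζ 0).2 -
      (gaussField ζ 0).1 * (gaussField ζ 0).2) (noiseMeasure ω₂) := (hI 1 0).sub (hI 0 0)
  have h123 : Integrable (fun ζ : Src => (gaussField ζ 1).1 * (gaussField ζ 0).2 -
      (gaussField ζ 0).1 * (gaussField ζ 0).2 + (gaussField ζ 1).1 * (gaussField ζ 1).2) (noiseMeasure ω₂) :=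
    h12.add (hI 1 1)
  rw [integral_const_mul, integral_sub h123 (hI 0 1), integral_add h12 (hI 1 1), integral_sub (hI 1 0) (hI 0 0),
    integral_q_mul_p, integral_q_mul_p, integral_q_mul_p, integral_q_mul_p]
  norm_num

end Summit.AtomisticToContinuum.FouriersLaw.Theorems.ParityLiouvilleSeed.HarmonicWitness

end
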